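import Literature.MathematicalPhysics.QuantumFieldTheory.ConformalBootstrap3D.BlockZSeries
import Mathlib.Analysis.SpecialFunctions.Pow.Real
import Mathlib.Analysis.SpecialFunctions.Sqrt
import Mathlib.Tactic.FieldSimp
import Mathlib.Tactic.LinearCombination
import Mathlib.Tactic.Positivity
import HarnessLib

/-!
# The radial coordinate `ρ` of Hogervorst–Rychkov and the kinematic identities of the radial frame

Hogervorst–Rychkov 2013 §3 eq. (3.1): the radial coordinate of a four-point configuration is
`ρ(z) = z / (1 + √(1-z))²`, with inverse `z(ρ) = 4ρ/(1+ρ)²`; it maps the cut plane `ℂ \ [1,∞)` onto the unit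
disc, and the real segment `0 ≤ z < 1` (where the tree's typed blocks live, `SigmaEpsilonSystem`) onto
`0 ≤ ρ < 1`. With `ρ̄ = ρ(z̄)`, `f₁ := (1-ρ)(1-ρ̄)` (`= 1 + r² - 2rη`) and `f₂ := (1+ρ)(1+ρ̄)` (`= 1 + r² + 2rη`,
`r² = ρρ̄`, `η = (ρ+ρ̄)/(2r)`), the cross-ratios are `u = z z̄ = 16ρρ̄/f₂²`, `v = (1-z)(1-z̄) = (f₁/f₂)²`
(Costa–Hansen–Penedones–Trevisani 2016 §2 eq. (2.7)). The exchange `x₁ ↔ x₂`, i.e. `z ↦ z/(z-1)`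
(Dolan–Osborn 2011 §2 eq. (2.23)), is `ρ ↦ -ρ` (Hogervorst–Rychkov 2013 §3, footnote), under which `f₁ ↔ f₂`.

This file is the elementary (real-variable, fully proved) part of the radial frame used by the pub-ising3d
odd-sector recipe R11 (AXIOMS-SOURCES §11): the maps `rhoOf`/`zOfRho` and their inverse relations on the real
segment, the bounds `z/4 ≤ ρ(z) ≤ z`, `ρ(1/2) = 3 - 2√2`, the `u, v, f₁, f₂` identities, the crossing map, the
CHPT prefactor identity `(f₁/f₂)^t = v^{t/2}` (so that for the `σε` conjugate pair the prefactor
`(f₂/f₁)^{|Δσε|}` of CHPT16 eq. (2.20) times `v^{|Δσε|/2}` is `1`), the rational node parametrisation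
`ρ = t²` (then `z`, `1-z` and `ρ(1-z) = ((1-t)/(1+t))²` are rational in `t`), `η ≥ 1` at real points, and the
parity of the radial monomials `𝒫_{E,j}(-x,-y) = (-1)^j 𝒫_{E,j}(x,y)` (`zMono` of `BlockZSeries`, which is the
SAME function whether fed `(z,z̄)` or `(ρ,ρ̄)`).

NOT here (deliberately): the radial expansion of a block and its convergence on `|ρ| < 1` (Hogervorst–Rychkov
2013 §3.1 give a physical argument; the tree's block predicate is stated in the `z`-frame), the 30-point
recurrence of CHPT16 (an arXiv ancillary file, not printed), and the non-negativity of the radial coefficients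
of the prefactored block (CHPT16 §2.1, "unitarity implies"). Those are recorded, with exact checks, in
pub-ising3d AXIOMS-SOURCES §11.
-/

namespace Literature.MathematicalPhysics.QuantumFieldTheory.ConformalBootstrap3D

open Finset

/-! ### The maps `z(ρ)` and `ρ(z)` -/

/-- `z(ρ) = 4ρ/(1+ρ)²` — the cross-ratio as a function of the radial coordinate.
[cite: HogervorstRychkov2013, §3 eq. (3.1)] -/
noncomputable def zOfRho (ρ : ℝ) : ℝ :=
  4 * ρ / (1 + ρ) ^ 2

/-- `ρ(z) = z/(1+√(1-z))²` — the radial coordinate of Hogervorst–Rychkov (real `z ≤ 1`; for `z > 1` the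
junk value uses `√(1-z) = 0`). [cite: HogervorstRychkov2013, §3 eq. (3.1)] -/
noncomputable def rhoOf (x : ℝ) : ℝ :=
  x / (1 + Real.sqrt (1 - x)) ^ 2

/-- `zOfRho` unfolded. [cite: HogervorstRychkov2013, §3 eq. (3.1)] -/
theorem zOfRho_def (ρ : ℝ) : zOfRho ρ = 4 * ρ / (1 + ρ) ^ 2 := rfl

/-- `rhoOf` unfolded. [cite: HogervorstRychkov2013, §3 eq. (3.1)] -/
theorem rhoOf_def (x : ℝ) : rhoOf x = x / (1 + Real.sqrt (1 - x)) ^ 2 := rfl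

/-- `0 < 1 + √(1-x)`. [folklore] -/
theorem one_add_sqrt_one_sub_pos (x : ℝ) : 0 < 1 + Real.sqrt (1 - x) :=
  add_pos_of_pos_of_nonneg one_pos (Real.sqrt_nonneg _)

/-- `ρ(z) = (1-q)/(1+q)` with `q = √(1-z)`, for `z ≤ 1` (since `z = (1-q)(1+q)`). [folklore] -/
theorem rhoOf_eq {x : ℝ} (hx : x ≤ 1) :
    rhoOf x = (1 - Real.sqrt (1 - x)) / (1 + Real.sqrt (1 - x)) := by
  have hq : Real.sqrt (1 - x) ^ 2 = 1 - x := Real.sq_sqrt (by linarith)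
  have hp := one_add_sqrt_one_sub_pos x
  rw [rhoOf_def, div_eq_div_iff (pow_pos hp 2).ne' hp.ne']
  linear_combination (1 + Real.sqrt (1 - x)) * hq

/-- `ρ(z) ≥ 0` for `z ≥ 0`. [folklore] -/
theorem rhoOf_nonneg {x : ℝ} (hx : 0 ≤ x) : 0 ≤ rhoOf x :=
  div_nonneg hx (pow_nonneg (one_add_sqrt_one_sub_pos x).le 2)

/-- `ρ(z) > 0` for `z > 0`. [folklore] -/
theorem rhoOf_pos {x : ℝ} (hx : 0 < x) : 0 < rhoOf x :=
  div_pos hx (pow_pos (one_add_sqrt_one_sub_pos x) 2)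

/-- `ρ(z) ≤ z` for `z ≥ 0` (the denominator `(1+√(1-z))²` is `≥ 1`): the radial expansion parameter is never
larger than the `z`-one, Hogervorst–Rychkov 2013 eq. (3.12) `|z(ρ)/ρ| > 1`.
[cite: HogervorstRychkov2013, §3.1 eq. (3.12)] -/
theorem rhoOf_le_self {x : ℝ} (hx : 0 ≤ x) : rhoOf x ≤ x := by
  rw [rhoOf_def]
  have h1 : 1 ≤ (1 + Real.sqrt (1 - x)) ^ 2 := by
    have := Real.sqrt_nonneg (1 - x)
    nlinarith
  exact div_le_self hx h1

/-- `z/4 ≤ ρ(z)` for `0 ≤ z` (since `√(1-z) ≤ 1`). [folklore] -/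
theorem div_four_le_rhoOf {x : ℝ} (hx : 0 ≤ x) : x / 4 ≤ rhoOf x := by
  rw [rhoOf_def]
  have hs : Real.sqrt (1 - x) ≤ 1 := by
    calc Real.sqrt (1 - x) ≤ Real.sqrt 1 := Real.sqrt_le_sqrt (by linarith)
      _ = 1 := Real.sqrt_one
  have h0 := Real.sqrt_nonneg (1 - x)
  have h4 : (1 + Real.sqrt (1 - x)) ^ 2 ≤ 4 := by nlinarith
  exact div_le_div_of_nonneg_left hx (pow_pos (one_add_sqrt_one_sub_pos x) 2) h4

/-- `ρ(z) < 1` for `z < 1`. [folklore] -/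
theorem rhoOf_lt_one {x : ℝ} (hx : x < 1) : rhoOf x < 1 := by
  rw [rhoOf_eq hx.le, div_lt_one (one_add_sqrt_one_sub_pos x)]
  have : 0 < Real.sqrt (1 - x) := Real.sqrt_pos.mpr (by linarith)
  linarith

/-- `-1 < ρ(z)` for `z ≤ 1`. [folklore] -/
theorem neg_one_lt_rhoOf {x : ℝ} (hx : x ≤ 1) : -1 < rhoOf x := by
  rw [rhoOf_eq hx, lt_div_iff₀ (one_add_sqrt_one_sub_pos x)]
  linarith

/-- `ρ(1) = 1`. [folklore] -/
theorem rhoOf_one : rhoOf 1 = 1 := by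
  simp [rhoOf_def]

/-- `ρ(0) = 0`. [folklore] -/
theorem rhoOf_zero : rhoOf 0 = 0 := by
  simp [rhoOf_def]

/-- The crossing-symmetric point: `ρ(1/2) = 3 - 2√2 ≈ 0.1716`. [cite: HogervorstRychkov2013, §3.1] -/
theorem rhoOf_half : rhoOf (1 / 2) = 3 - 2 * Real.sqrt 2 := by
  have h2 : Real.sqrt 2 ^ 2 = 2 := Real.sq_sqrt (by norm_num)
  have hs : Real.sqrt (1 - 1 / 2) = Real.sqrt 2 / 2 := by
    rw [show (1 : ℝ) - 1 / 2 = (Real.sqrt 2 / 2) ^ 2 by nlinarith [h2]]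
    exact Real.sqrt_sq (by positivity)
  rw [rhoOf_eq (by norm_num), hs]
  have hp : 0 < 1 + Real.sqrt 2 / 2 := by positivity
  rw [div_eq_iff hp.ne']
  linear_combination h2

/-- `z(ρ(x)) = x` for `x ≤ 1`: `zOfRho` is a left inverse of `rhoOf` on the real segment.
[cite: HogervorstRychkov2013, §3 eq. (3.1)] -/
theorem zOfRho_rhoOf {x : ℝ} (hx : x ≤ 1) : zOfRho (rhoOf x) = x := by
  have hq : Real.sqrt (1 - x) ^ 2 = 1 - x := Real.sq_sqrt (by linarith)
  have hp := one_add_sqrt_one_sub_pos x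
  rw [rhoOf_eq hx]
  set q := Real.sqrt (1 - x) with hqdef
  rw [show x = 1 - q ^ 2 by linarith, zOfRho_def]
  have h1 : 1 + (1 - q) / (1 + q) = 2 / (1 + q) := by
    field_simp
    ring
  rw [h1, div_pow]
  field_simp
  ring

/-- `1 - z(ρ) = ((1-ρ)/(1+ρ))²` (`ρ ≠ -1`): `v` along one variable. [cite: CostaHansenPenedonesTrevisani2016, §2 eq. (2.7)] -/
theorem one_sub_zOfRho {ρ : ℝ} (hρ : ρ ≠ -1) : 1 - zOfRho ρ = ((1 - ρ) / (1 + ρ)) ^ 2 := by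
  have h : 1 + ρ ≠ 0 := fun h => hρ (by linarith)
  rw [zOfRho_def]
  field_simp
  ring

/-- `0 ≤ z(ρ)` for `ρ ≥ 0`. [folklore] -/
theorem zOfRho_nonneg {ρ : ℝ} (hρ : 0 ≤ ρ) : 0 ≤ zOfRho ρ := by
  rw [zOfRho_def]; positivity

/-- `z(ρ) ≤ 1` for `ρ > -1` (`4ρ ≤ (1+ρ)²`). [folklore] -/
theorem zOfRho_le_one {ρ : ℝ} (hρ : -1 < ρ) : zOfRho ρ ≤ 1 := by
  have : 0 ≤ ((1 - ρ) / (1 + ρ)) ^ 2 := sq_nonneg _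
  rw [← one_sub_zOfRho hρ.ne'] at this
  linarith

/-- `z(ρ) < 1` for `-1 < ρ`, `ρ ≠ 1`. [folklore] -/
theorem zOfRho_lt_one {ρ : ℝ} (hρ : -1 < ρ) (h1 : ρ ≠ 1) : zOfRho ρ < 1 := by
  have hne : (1 - ρ) / (1 + ρ) ≠ 0 := by
    have : 1 + ρ ≠ 0 := by linarith
    have : 1 - ρ ≠ 0 := fun h => h1 (by linarith)
    positivity
  have : 0 < ((1 - ρ) / (1 + ρ)) ^ 2 := by positivity
  rw [← one_sub_zOfRho hρ.ne'] at this
  linarith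

/-- `ρ(z(ρ)) = ρ` for `-1 < ρ ≤ 1`: on the real segment the two maps are mutually inverse.
[cite: HogervorstRychkov2013, §3 eq. (3.1)] -/
theorem rhoOf_zOfRho {ρ : ℝ} (h0 : -1 < ρ) (h1 : ρ ≤ 1) : rhoOf (zOfRho ρ) = ρ := by
  have hp : 0 < 1 + ρ := by linarith
  have hs : Real.sqrt (1 - zOfRho ρ) = (1 - ρ) / (1 + ρ) := by
    rw [one_sub_zOfRho h0.ne']
    exact Real.sqrt_sq (div_nonneg (by linarith) hp.le)
  rw [rhoOf_eq (zOfRho_le_one h0), hs]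
  field_simp
  ring

/-- `ρ` is strictly increasing on `z ≤ 1`. [folklore] -/
theorem rhoOf_lt_rhoOf {x y : ℝ} (hxy : x < y) (hy : y ≤ 1) : rhoOf x < rhoOf y := by
  rw [rhoOf_eq (hxy.le.trans hy), rhoOf_eq hy]
  have hqx := one_add_sqrt_one_sub_pos x
  have hqy := one_add_sqrt_one_sub_pos y
  have hlt : Real.sqrt (1 - y) < Real.sqrt (1 - x) :=
    Real.sqrt_lt_sqrt (by linarith) (by linarith)
  rw [div_lt_div_iff₀ hqx hqy]
  nlinarith

/-! ### The crossing map `x₁ ↔ x₂`: `z ↦ z/(z-1)` is `ρ ↦ -ρ` -/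

/-- `z(-ρ) = z(ρ)/(z(ρ)-1)` for `ρ ≠ ±1`: the exchange `x₁ ↔ x₂` (`u → u/v`, `v → 1/v`, `z → z/(z-1)`,
Dolan–Osborn 2011 eq. (2.23)) is `ρ → -ρ` in the radial frame. [cite: HogervorstRychkov2013, §3] -/
theorem zOfRho_neg {ρ : ℝ} (h1 : ρ ≠ 1) (h2 : ρ ≠ -1) : zOfRho (-ρ) = zOfRho ρ / (zOfRho ρ - 1) := by
  have hp : 1 + ρ ≠ 0 := fun h => h2 (by linarith)
  have hm : 1 - ρ ≠ 0 := fun h => h1 (by linarith)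
  have hm' : 1 + -ρ ≠ 0 := by rw [← sub_eq_add_neg]; exact hm
  have hden : zOfRho ρ - 1 = -((1 - ρ) / (1 + ρ)) ^ 2 := by
    rw [← one_sub_zOfRho h2]; ring
  have hden0 : zOfRho ρ - 1 ≠ 0 := by
    rw [hden, neg_ne_zero]; positivity
  rw [eq_div_iff hden0, hden, zOfRho_def, zOfRho_def]
  field_simp
  ring

/-- For real `x < 1`: `x/(x-1) = z(-ρ(x))` — the image point of the `x₁ ↔ x₂` exchange lies at the radial
coordinate `-ρ(x)`; in particular it is OUTSIDE the unit `z`-disc as soon as `x > 1/2`, while its radial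
coordinate has modulus `ρ(x) < 1`. [cite: HogervorstRychkov2013, §3] -/
theorem div_self_sub_one_eq_zOfRho_neg_rhoOf {x : ℝ} (hx : x < 1) :
    x / (x - 1) = zOfRho (-rhoOf x) := by
  rw [zOfRho_neg (rhoOf_lt_one hx).ne (neg_one_lt_rhoOf hx.le).ne', zOfRho_rhoOf hx.le]

/-! ### Two-variable kinematics: `f₁`, `f₂`, `u`, `v`, `η` -/

/-- `f₁(ρ,ρ̄) := (1-ρ)(1-ρ̄)` (`= 1 + r² - 2rη`). [cite: CostaHansenPenedonesTrevisani2016, §2 eq. (2.7)] -/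
def radialF1 (ρ ρb : ℝ) : ℝ := (1 - ρ) * (1 - ρb)

/-- `f₂(ρ,ρ̄) := (1+ρ)(1+ρ̄)` (`= 1 + r² + 2rη`). [cite: CostaHansenPenedonesTrevisani2016, §2 eq. (2.7)] -/
def radialF2 (ρ ρb : ℝ) : ℝ := (1 + ρ) * (1 + ρb)

/-- `f₁` unfolded. [cite: CostaHansenPenedonesTrevisani2016, §2 eq. (2.7)] -/
theorem radialF1_def (ρ ρb : ℝ) : radialF1 ρ ρb = (1 - ρ) * (1 - ρb) := rfl

/-- `f₂` unfolded. [cite: CostaHansenPenedonesTrevisani2016, §2 eq. (2.7)] -/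
theorem radialF2_def (ρ ρb : ℝ) : radialF2 ρ ρb = (1 + ρ) * (1 + ρb) := rfl

/-- `f₁ = 1 + r² - 2rη` and `f₂ = 1 + r² + 2rη` in the form `1 + ρρ̄ ∓ (ρ+ρ̄)`. [cite: CostaHansenPenedonesTrevisani2016, §2 eq. (2.7)] -/
theorem radialF1_eq (ρ ρb : ℝ) : radialF1 ρ ρb = 1 + ρ * ρb - (ρ + ρb) := by
  rw [radialF1_def]; ring

/-- See `radialF1_eq`. [cite: CostaHansenPenedonesTrevisani2016, §2 eq. (2.7)] -/
theorem radialF2_eq (ρ ρb : ℝ) : radialF2 ρ ρb = 1 + ρ * ρb + (ρ + ρb) := by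
  rw [radialF2_def]; ring

/-- `f₁ > 0` on `(-1,1)²`. [folklore] -/
theorem radialF1_pos {ρ ρb : ℝ} (hρ : ρ < 1) (hρb : ρb < 1) : 0 < radialF1 ρ ρb := by
  rw [radialF1_def]; exact mul_pos (by linarith) (by linarith)

/-- `f₂ > 0` on `(-1,1)²`. [folklore] -/
theorem radialF2_pos {ρ ρb : ℝ} (hρ : -1 < ρ) (hρb : -1 < ρb) : 0 < radialF2 ρ ρb := by
  rw [radialF2_def]; exact mul_pos (by linarith) (by linarith)

/-- `ρ ↦ -ρ` swaps `f₁` and `f₂`. [cite: HogervorstRychkov2013, §3] -/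
theorem radialF1_neg_neg (ρ ρb : ℝ) : radialF1 (-ρ) (-ρb) = radialF2 ρ ρb := by
  rw [radialF1_def, radialF2_def]; ring

/-- `ρ ↦ -ρ` swaps `f₂` and `f₁`. [cite: HogervorstRychkov2013, §3] -/
theorem radialF2_neg_neg (ρ ρb : ℝ) : radialF2 (-ρ) (-ρb) = radialF1 ρ ρb := by
  rw [radialF1_def, radialF2_def]; ring

/-- `u = z z̄ = 16ρρ̄/f₂²`. [cite: CostaHansenPenedonesTrevisani2016, §2 eq. (2.7)] -/
theorem zOfRho_mul_zOfRho (ρ ρb : ℝ) :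
    zOfRho ρ * zOfRho ρb = 16 * (ρ * ρb) / radialF2 ρ ρb ^ 2 := by
  rw [zOfRho_def, zOfRho_def, radialF2_def, div_mul_div_comm]
  congr 1 <;> ring

/-- `v = (1-z)(1-z̄) = (f₁/f₂)²` (`ρ, ρ̄ ≠ -1`). [cite: CostaHansenPenedonesTrevisani2016, §2 eq. (2.7)] -/
theorem one_sub_zOfRho_mul (ρ ρb : ℝ) (hρ : ρ ≠ -1) (hρb : ρb ≠ -1) :
    (1 - zOfRho ρ) * (1 - zOfRho ρb) = (radialF1 ρ ρb / radialF2 ρ ρb) ^ 2 := by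
  rw [one_sub_zOfRho hρ, one_sub_zOfRho hρb, radialF1_def, radialF2_def]
  have : 1 + ρ ≠ 0 := fun h => hρ (by linarith)
  have : 1 + ρb ≠ 0 := fun h => hρb (by linarith)
  field_simp

/-- `η(ρ,ρ̄) := (ρ+ρ̄)/(2√(ρρ̄))` — the cosine variable of the radial frame (`η = cos θ` in the Euclidean section
`ρ̄ = ρ*`; the Gegenbauer/Legendre argument of CHPT16 eq. (2.11)). [cite: CostaHansenPenedonesTrevisani2016, §2 eq. (2.6)] -/
noncomputable def radialEta (ρ ρb : ℝ) : ℝ := (ρ + ρb) / (2 * Real.sqrt (ρ * ρb))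

/-- `radialEta` unfolded. [cite: CostaHansenPenedonesTrevisani2016, §2 eq. (2.6)] -/
theorem radialEta_def (ρ ρb : ℝ) : radialEta ρ ρb = (ρ + ρb) / (2 * Real.sqrt (ρ * ρb)) := rfl

/-- At REAL points `0 < ρ, ρ̄` one has `η ≥ 1` (AM–GM) — so the Legendre polynomials `P_j(η)` of the radial
expansion are evaluated to the right of `1`, where they are `≥ 1 > 0`; the tree encodes `r^j P_j(η)` as the
manifestly non-negative form `zLegendre j ρ ρ̄`. [folklore] -/
theorem one_le_radialEta {ρ ρb : ℝ} (hρ : 0 < ρ) (hρb : 0 < ρb) : 1 ≤ radialEta ρ ρb := by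
  have hs : Real.sqrt (ρ * ρb) ^ 2 = ρ * ρb := Real.sq_sqrt (mul_pos hρ hρb).le
  have hs0 : 0 < Real.sqrt (ρ * ρb) := Real.sqrt_pos.mpr (mul_pos hρ hρb)
  rw [radialEta_def, le_div_iff₀ (by positivity), one_mul]
  nlinarith [sq_nonneg (ρ - ρb), sq_nonneg (ρ + ρb - 2 * Real.sqrt (ρ * ρb))]

/-! ### The CHPT prefactor and `v` -/

/-- `(f₁/f₂)^t = v^{t/2}` with `v = (1-z(ρ))(1-z(ρ̄))`, on `(-1,1)²`: the kinematic prefactor of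
Costa–Hansen–Penedones–Trevisani 2016 eq. (2.20), `𝒫 ∝ (f₂/f₁)^{(Δ₁₂-Δ₃₄)/2}`, is a power of `v`.
[cite: CostaHansenPenedonesTrevisani2016, §2.2 eq. (2.20)] -/
theorem radialF1_div_radialF2_rpow {ρ ρb : ℝ} (hρ : -1 < ρ) (hρ1 : ρ < 1) (hρb : -1 < ρb) (hρb1 : ρb < 1)
    (t : ℝ) :
    (radialF1 ρ ρb / radialF2 ρ ρb) ^ t = ((1 - zOfRho ρ) * (1 - zOfRho ρb)) ^ (t / 2) := by
  have hq : 0 ≤ radialF1 ρ ρb / radialF2 ρ ρb :=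
    div_nonneg (radialF1_pos hρ1 hρb1).le (radialF2_pos hρ hρb).le
  rw [one_sub_zOfRho_mul ρ ρb hρ.ne' hρb.ne', ← Real.rpow_natCast _ 2, ← Real.rpow_mul hq]
  congr 1
  push_cast
  ring

/-- For the `σε` conjugate pair (`Δ₁₂ = -Δ₃₄`, prefactor exponent `|Δσε|`): `(f₂/f₁)^c · v^{c/2} = 1` on
`(-1,1)²` — the CHPT prefactor of the `⟨εσσε⟩` block and the factor `v^{-Δσε/2}` of the `x₁ ↔ x₂` relation
`g^{s,s} = (-1)^ℓ v^{-s/2} g^{-s,s}∘(z ↦ z/(z-1))` (Dolan–Osborn 2011 eq. (2.23)) cancel exactly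
(pub-ising3d AXIOMS-SOURCES S11.6). [cite: CostaHansenPenedonesTrevisani2016, §2.2 eq. (2.20)] -/
theorem radialF2_div_radialF1_rpow_mul_v_rpow {ρ ρb : ℝ} (hρ : -1 < ρ) (hρ1 : ρ < 1) (hρb : -1 < ρb)
    (hρb1 : ρb < 1) (c : ℝ) :
    (radialF2 ρ ρb / radialF1 ρ ρb) ^ c * ((1 - zOfRho ρ) * (1 - zOfRho ρb)) ^ (c / 2) = 1 := by
  have h1 := radialF1_pos hρ1 hρb1
  have h2 := radialF2_pos hρ hρb
  rw [← radialF1_div_radialF2_rpow hρ hρ1 hρb hρb1 c, ← Real.mul_rpow (div_nonneg h2.le h1.le)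
    (div_nonneg h1.le h2.le), div_mul_div_comm, mul_comm (radialF2 ρ ρb), div_self (mul_pos h1 h2).ne',
    Real.one_rpow]

/-! ### Rational node parametrisation `ρ = t²` -/

/-- `z(t²) = (2t/(1+t²))²`: choosing `ρ = t²` with rational `t` makes `z` a rational SQUARE.
[cite: HogervorstRychkov2013, §3 eq. (3.1)] -/
theorem zOfRho_sq (t : ℝ) : zOfRho (t ^ 2) = (2 * t / (1 + t ^ 2)) ^ 2 := by
  rw [zOfRho_def]
  have : 1 + t ^ 2 ≠ 0 := by positivity
  field_simp
  ring

/-- `1 - z(t²) = ((1-t²)/(1+t²))²`. [cite: HogervorstRychkov2013, §3 eq. (3.1)] -/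
theorem one_sub_zOfRho_sq (t : ℝ) : 1 - zOfRho (t ^ 2) = ((1 - t ^ 2) / (1 + t ^ 2)) ^ 2 :=
  one_sub_zOfRho (ne_of_gt (by have := sq_nonneg t; linarith))

/-- `ρ(1 - z(t²)) = ((1-t)/(1+t))²` for `0 ≤ t`: with `ρ = t²` the REFLECTED node `1 - z` also has a rational
radial coordinate (a square again), so both the direct and the crossed radial variables of a certificate
node are rational in `t` (pub-ising3d recipe R11(c)). [cite: HogervorstRychkov2013, §3 eq. (3.1)] -/
theorem rhoOf_one_sub_zOfRho_sq {t : ℝ} (ht : 0 ≤ t) :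
    rhoOf (1 - zOfRho (t ^ 2)) = ((1 - t) / (1 + t)) ^ 2 := by
  have hp : 0 < 1 + t ^ 2 := by positivity
  have hz : 0 ≤ zOfRho (t ^ 2) := zOfRho_nonneg (sq_nonneg t)
  have hs : Real.sqrt (1 - (1 - zOfRho (t ^ 2))) = 2 * t / (1 + t ^ 2) := by
    rw [sub_sub_cancel, zOfRho_sq]
    exact Real.sqrt_sq (by positivity)
  rw [rhoOf_eq (by linarith), hs]
  have h1 : 1 + t ≠ 0 := by
    have h1' : (0 : ℝ) < 1 + t := by positivity
    exact h1'.ne'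
  field_simp
  ring

/-! ### Parity of the radial monomials -/

/-- `𝒫_j(-x,-y) = (-1)^j 𝒫_j(x,y)` for the Legendre form `zLegendre j` (homogeneous of degree `j`). [folklore] -/
theorem zLegendre_neg_neg (j : ℕ) (x y : ℝ) : zLegendre j (-x) (-y) = (-1) ^ j * zLegendre j x y := by
  unfold zLegendre
  rw [mul_sum]
  refine sum_congr rfl fun c hc => ?_
  rw [mem_antidiagonal] at hc
  rw [neg_pow x, neg_pow y, ← hc, pow_add]
  ring

/-- `𝒫_{E,j}(-x,-y) = (-1)^j 𝒫_{E,j}(x,y)`: under the crossing map `ρ ↦ -ρ` (i.e. `x₁ ↔ x₂`) the radial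
monomial `r^E P_j(η)` of spin `j` picks up `(-1)^j` (`η ↦ -η`); since the spins at radial level `m` of a
spin-`ℓ` block have the parity of `ℓ + m`, this is the level sign `(-1)^{ℓ+m}` of the `x₁ ↔ x₂`-related block
(pub-ising3d AXIOMS-SOURCES S11.6). [cite: HogervorstRychkov2013, §3] -/
theorem zMono_neg_neg (E : ℝ) (j : ℕ) (x y : ℝ) : zMono E j (-x) (-y) = (-1) ^ j * zMono E j x y := by
  unfold zMono
  rw [neg_mul_neg, zLegendre_neg_neg]
  ring

end Literature.MathematicalPhysics.QuantumFieldTheory.ConformalBootstrap3D
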